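import Literature.Barriers.QuantumFields.FiniteTemperatureOneLayerGD
import HarnessLib

/-!
# Borgs–Seiler's one-layer infrared bound (Thm III.4) and deconfinement at maximal lattice
# temperature (Cor. III.5), proved

Companion to `FiniteTemperatureOneLayer` / `…Reflection` / `…GD`. From Gaussian domination
`Z(h) ≤ Z(0)` for the one-layer model (`OneLayer.gaussZ_le_gaussZ_zero`) we derive, "in the
standard way: Expanding the inequality to second order in the perturbation `h`" (Borgs–Seiler,
p. 346; Friedli–Velenik 2017, proof of Thm. 10.24):

* `OneLayer.integral_weight_shiftLin_sq_le` — the second-order consequence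
  `J_E ∫ e^{-S} X_h² ≤ N ‖h‖² Z(0)`, `X_h = Σ_b Re(h̄_b (χ(u_x) - χ(u_{x+eᵢ})))` ((III.13)–(III.15):
  `⟨(Re(u, Δh))²⟩ ≤ …/J_E`), via `Z(th) + Z(-th) ≤ 2 Z(0)` and `e^a + e^{-a} ≥ 2 + a²` (no
  differentiation, as in the tree's `NVector.integral_weight_vecGradForm_sq_le`);
* plane waves `h_{x,i} = δ_{i,i₀} c χ_k(x)` (and `c χ̄_k(x)`), `c ∈ {1, i}`:
  `⟨|Σ_x χ̄_k(x)(χ(u_x) - χ(u_{x+e_{i₀}}))|²⟩ ≤ 2 N L^d / J_E` (`OneLayer.expectation_normSq_charGrad_le`),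
  and `Σ_x χ̄_k(x) χ(u_{x+e}) = χ_k(e) Σ_x χ̄_k(x) χ(u_x)`, `|1 - χ_k(e_{i₀})|² = 2(1 - cos p_{i₀})`;
* translation invariance and positivity of the finite-temperature Polyakov kernel (the tree's
  `FiniteTemperature.polyakovKernel_add`) give `Re Ĝ_L(k) = (⟨|Σ χ̄_k χ|²⟩ + ⟨|Σ χ_k χ|²⟩)/(2L^d)`,
  whence **Theorem III.4** in the tree's predicate form
  `FiniteTemperature.HasPolyakovInfraredBound d 1 ρ (fun J => N / J)`
  (`hasPolyakovInfraredBound_one`): `(1 - cos pᵢ) Re Ĝ_L(p) ≤ N/J_E` for every compact group with a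
  continuous unitary `N × N` representation (Borgs–Seiler: "for any compact Lie group",
  `Σᵢ(1 - cos pᵢ) Ĝ(p) ≤ const/J_E`, (III.16)), every `d`, even `L ≥ 4`, `J_E, J_M > 0`, `p ≠ 0`;
* **Corollary III.5** (`hasPolyakovLongRangeOrder_one`, `…_unitary`, `…_specialUnitary`): in
  `d ≥ 3` there is `J₀` with Polyakov long-range order at `L₀ = 1` for all `J_E ≥ J₀`, `J_M > 0`
  ("with Wilson's action and maximal lattice temperature external "quarks" are liberated"), by the
  tree's mechanism `hasPolyakovLongRangeOrder_of_infraredBound` and the proved diagonal bound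
  `one_le_polyakovCorrelation_zero`;
* hence the **temperature-blind barrier theorems of `FiniteTemperatureDeconfinement` hold
  unconditionally** (`not_temperatureBlindPolyakovConfinement_unitary_holds`, `…_specialUnitary_holds`,
  `not_temperatureBlindUniformClustering_unitary_holds`, `…_specialUnitary_holds`): the classes were
  refuted there from the named fact at the single temporal extent `L₀ = 1`, which is now a theorem;
* and the catalogued fact itself is reduced to the one remaining named fact:
  `FiniteTemperatureDeconfinement.of_borgsSeilerInfraredBound : BorgsSeilerInfraredBound → FiniteTemperatureDeconfinement`
  (the `L₀ ≥ 2` infrared bound, Borgs–Seiler Lemma III.6, whose printed proof is the transfer-matrix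
  double-commutator expansion of §III.2).

Everything here is proved; no facts.

References: C. Borgs, E. Seiler, Commun. Math. Phys. 91 (1983) 329–380, §III.1 (III.12)–(III.18),
Thm III.4, Cor. III.5 and its proof (pp. 346–348); S. Friedli, Y. Velenik, *Statistical Mechanics of
Lattice Systems* (CUP 2017), §10.5.3, proof of Thm. 10.24. [BorgsSeiler1983] [FriedliVelenik2017]
-/

noncomputable section

open MeasureTheory Filter Topology
open scoped ComplexConjugate

namespace Literature.Barriers.QuantumFields

namespace OneLayer

open Literature.Probability.LatticeModels (TorusSite torusChar torusFourier latticeMomentum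
  torusChar_add_right torusChar_sub_right norm_torusChar torusChar_single normSq_one_sub_exp_mul_I
  torusFourier_eq_sum_torusChar)
open Literature.MathematicalPhysics.QuantumFieldTheory (haarProbability)
open Literature.MathematicalPhysics.QuantumFieldTheory.LatticeRP (piMeasure)
open FiniteTemperature (Dir)

/-! ### The second-order consequence of Gaussian domination -/

section SecondOrder

variable {d L : ℕ} {G : Type*} [Group G] {N : ℕ} (ρ : G →* Matrix (Fin N) (Fin N) ℂ)

/-- The linear response `X_h(U) = Σ_b Re(h̄_b (χ(u_x) - χ(u_{x+eᵢ})))` (Borgs–Seiler's `Re(u, Δh)`). [cite: BorgsSeiler1983, §III.1 (III.12)–(III.13) (p. 346)] -/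
def shiftLin [NeZero L] (h : TorusSite d L × Fin d → ℂ) (U : Config d L G) : ℝ :=
  ∑ b : TorusSite d L × Fin d, (conj (h b) * (polyakov ρ U b.1 - polyakov ρ U (b.1 + Pi.single b.2 1))).re

/-- `‖h‖² = Σ_b |h_b|²`. [folklore] -/
def fieldNormSq [NeZero L] (h : TorusSite d L × Fin d → ℂ) : ℝ := ∑ b : TorusSite d L × Fin d, ‖h b‖ ^ 2

/-- The shift terms of `t h`: `Σ_b shiftTerm(th) = t X_h - (N/2) t² ‖h‖²`. [folklore] -/
theorem sum_shiftTerm_smul [NeZero L] (t : ℝ) (h : TorusSite d L × Fin d → ℂ) (U : Config d L G) :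
    ∑ b : TorusSite d L × Fin d, shiftTerm ρ (t • h) U b =
      t * shiftLin ρ h U - (N / 2 : ℝ) * t ^ 2 * fieldNormSq h := by
  unfold shiftLin fieldNormSq shiftTerm
  rw [Finset.sum_sub_distrib, Finset.mul_sum, Finset.mul_sum]
  congr 1
  · refine Finset.sum_congr rfl fun b _ => ?_
    rw [Pi.smul_apply, Complex.real_smul, map_mul, Complex.conj_ofReal, mul_assoc, Complex.re_ofReal_mul]
  · refine Finset.sum_congr rfl fun b _ => ?_
    rw [Pi.smul_apply, norm_smul, mul_pow, Real.norm_eq_abs, sq_abs]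
    ring

variable [TopologicalSpace G] [IsTopologicalGroup G] [CompactSpace G] [MeasurableSpace G]
  [BorelSpace G]

/-- `Z(th) = e^{-J_E (N/2) t² ‖h‖²} ∫ e^{-S} e^{J_E t X_h}`. [cite: BorgsSeiler1983, §III.1 (III.12) (p. 346)] -/
theorem gaussZ_smul [NeZero L] (JE JM t : ℝ) (h : TorusSite d L × Fin d → ℂ) :
    gaussZ ρ JE JM (t • h) = Real.exp (-(JE * (N / 2 : ℝ) * fieldNormSq h) * t ^ 2) *
      ∫ U, weight ρ JE JM U * Real.exp (JE * t * shiftLin ρ h U)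
        ∂piMeasure (ι := Link d L) (haarProbability G) := by
  unfold gaussZ zWeight
  rw [← integral_const_mul]
  refine integral_congr_ae (ae_of_all _ fun U => ?_)
  simp only
  rw [sum_shiftTerm_smul, mul_left_comm, ← Real.exp_add]
  congr 2
  ring

omit [IsTopologicalGroup G] [CompactSpace G] [MeasurableSpace G] [BorelSpace G] in
/-- `X_h` is continuous. [folklore] -/
theorem continuous_shiftLin [NeZero L] (hρ : Continuous ρ) (h : TorusSite d L × Fin d → ℂ) :
    Continuous (shiftLin (G := G) ρ h) := by
  unfold shiftLin
  exact continuous_finsetSum _ fun b _ => Complex.continuous_re.comp (continuous_const.mul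
    ((continuous_polyakov ρ hρ _).sub (continuous_polyakov ρ hρ _)))

variable [SecondCountableTopology G]

/-- **The second-order consequence of Gaussian domination** (Borgs–Seiler (III.12)–(III.15);
Friedli–Velenik 2017, (10.46)–(10.47)): if `Z(th) ≤ Z(0)` for all real `t` and `J_E > 0`, then
`J_E ∫ e^{-S} X_h² ≤ N ‖h‖² ∫ e^{-S}`, i.e. `⟨X_h²⟩ ≤ (N/J_E) Σ_b |h_b|²`. Proof: `Z(th) + Z(-th) ≤ 2Z(0)`
and `e^{a} + e^{-a} ≥ 2 + a²` give `Z₀ + (J_E²/2) t² ∫ e^{-S}X² ≤ Z₀ e^{J_E (N/2)‖h‖² t²}`; expand to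
first order in `t²`. [cite: BorgsSeiler1983, §III.1 (III.12)–(III.15) (p. 346)] -/
theorem integral_weight_shiftLin_sq_le [NeZero L] (hρ : Continuous ρ) {JE : ℝ} (hJE : 0 < JE) (JM : ℝ)
    (h : TorusSite d L × Fin d → ℂ)
    (hGD : ∀ t : ℝ, gaussZ ρ JE JM (t • h) ≤ gaussZ ρ JE JM (0 : TorusSite d L × Fin d → ℂ)) :
    JE * ∫ U, weight ρ JE JM U * shiftLin ρ h U ^ 2 ∂piMeasure (ι := Link d L) (haarProbability G) ≤
      N * fieldNormSq h * ∫ U, weight ρ JE JM U ∂piMeasure (ι := Link d L) (haarProbability G) := by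
  set μ : Measure (Config d L G) := piMeasure (ι := Link d L) (haarProbability G) with hμ
  set w : Config d L G → ℝ := fun U => weight ρ JE JM U with hw
  set A : Config d L G → ℝ := fun U => shiftLin ρ h U with hA
  set κ : ℝ := JE * (N / 2 : ℝ) * fieldNormSq h with hκ
  set Z₀ : ℝ := ∫ U, w U ∂μ with hZ₀
  set S : ℝ := ∫ U, w U * A U ^ 2 ∂μ with hS
  show JE * S ≤ N * fieldNormSq h * Z₀
  have hwc : Continuous w := continuous_weight ρ hρ JE JM
  have hAc : Continuous A := continuous_shiftLin ρ hρ h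
  have hint : ∀ {f : Config d L G → ℝ}, Continuous f → Integrable f μ := fun hf =>
    integrable_of_continuous hf
  have hw_pos : ∀ U, 0 < w U := fun U => weight_pos ρ JE JM U
  have hZ₀_pos : 0 < Z₀ := partitionFunction_pos ρ hρ JE JM
  have hS0 : 0 ≤ S := integral_nonneg fun U => mul_nonneg (hw_pos U).le (sq_nonneg _)
  have hF0 : 0 ≤ fieldNormSq h := Finset.sum_nonneg fun b _ => sq_nonneg _
  have hκ0 : 0 ≤ κ := by rw [hκ]; positivity
  have hZ0 : gaussZ ρ JE JM (0 : TorusSite d L × Fin d → ℂ) = Z₀ := gaussZ_zero ρ JE JM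
  -- the lower bound `Z(th) + Z(-th) ≥ e^{-κt²} (2Z₀ + J_E² t² S)`
  have hlow : ∀ t : ℝ, Real.exp (-κ * t ^ 2) * (2 * Z₀ + JE ^ 2 * t ^ 2 * S) ≤
      gaussZ ρ JE JM (t • h) + gaussZ ρ JE JM ((-t) • h) := by
    intro t
    rw [gaussZ_smul, gaussZ_smul, show (-t) ^ 2 = t ^ 2 by ring, ← mul_add]
    refine mul_le_mul_of_nonneg_left ?_ (Real.exp_pos _).le
    have hi1 : Integrable (fun U => w U * Real.exp (JE * t * A U)) μ := hint (by fun_prop)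
    have hi2 : Integrable (fun U => w U * Real.exp (JE * -t * A U)) μ := hint (by fun_prop)
    have hi3 : Integrable (fun U => w U * (2 + (JE * t * A U) ^ 2)) μ := hint (by fun_prop)
    rw [← integral_add hi1 hi2]
    calc 2 * Z₀ + JE ^ 2 * t ^ 2 * S = ∫ U, w U * (2 + (JE * t * A U) ^ 2) ∂μ := by
          rw [hZ₀, hS, ← integral_const_mul, ← integral_const_mul, ← integral_add
            ((hint hwc).const_mul _) ((hint (by fun_prop)).const_mul _)]
          refine integral_congr_ae (ae_of_all _ fun U => ?_)
          simp only
          ring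
      _ ≤ ∫ U, w U * Real.exp (JE * t * A U) + w U * Real.exp (JE * -t * A U) ∂μ := by
          refine integral_mono hi3 (hi1.add hi2) fun U => ?_
          simp only
          rw [← mul_add]
          refine mul_le_mul_of_nonneg_left ?_ (hw_pos U).le
          have e2 : JE * -t * A U = -(JE * t * A U) := by ring
          rw [e2]
          exact Literature.Probability.LatticeModels.NVector.two_add_sq_le_exp_add_exp_neg _
  -- hence `Z₀ + (J_E²/2) S u ≤ Z₀ e^{κu}` for `u ≥ 0`
  have hphi : ∀ u : ℝ, 0 ≤ u → Z₀ + JE ^ 2 / 2 * S * u ≤ Z₀ * Real.exp (κ * u) := by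
    intro u hu
    have h1 := (hlow (Real.sqrt u)).trans (add_le_add (hGD _) (hGD _))
    rw [Real.sq_sqrt hu, hZ0] at h1
    have hexp : Real.exp (-κ * u) * Real.exp (κ * u) = 1 := by
      rw [← Real.exp_add]; convert Real.exp_zero using 2; ring
    have h2 := mul_le_mul_of_nonneg_right h1 (Real.exp_pos (κ * u)).le
    have h3 : Real.exp (-κ * u) * (2 * Z₀ + JE ^ 2 * u * S) * Real.exp (κ * u) =
        2 * (Z₀ + JE ^ 2 / 2 * S * u) := by
      calc Real.exp (-κ * u) * (2 * Z₀ + JE ^ 2 * u * S) * Real.exp (κ * u)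
          = (2 * Z₀ + JE ^ 2 * u * S) * (Real.exp (-κ * u) * Real.exp (κ * u)) := by ring
        _ = 2 * (Z₀ + JE ^ 2 / 2 * S * u) := by rw [hexp]; ring
    rw [h3] at h2
    linarith
  -- first-order expansion at `u = 0`: `(J_E²/2) S ≤ Z₀ κ`
  suffices hmain : JE ^ 2 / 2 * S ≤ Z₀ * κ by
    rw [hκ] at hmain
    have : JE * (JE * S) ≤ JE * (N * fieldNormSq h * Z₀) := by nlinarith
    exact le_of_mul_le_mul_left this hJE
  by_contra hcon
  push Not at hcon
  have hderiv : HasDerivAt (fun u : ℝ => Z₀ * Real.exp (κ * u)) (Z₀ * κ) 0 := by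
    have h1 : HasDerivAt (fun u : ℝ => κ * u) κ 0 := by
      simpa using (hasDerivAt_id (0 : ℝ)).const_mul κ
    have h2 := (Real.hasDerivAt_exp (κ * 0)).comp 0 h1
    simp only [mul_zero, Real.exp_zero, one_mul] at h2
    simpa using h2.const_mul Z₀
  rw [hasDerivAt_iff_tendsto_slope_zero] at hderiv
  have hev : ∀ᶠ u : ℝ in 𝓝[>] 0, u⁻¹ * (Z₀ * Real.exp (κ * u) - Z₀) < JE ^ 2 / 2 * S := by
    have ht := hderiv.mono_left (nhdsGT_le_nhdsNE 0)
    simp only [zero_add, mul_zero, Real.exp_zero, mul_one, smul_eq_mul] at ht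
    exact ht.eventually (gt_mem_nhds hcon)
  obtain ⟨u, hu, hupos⟩ := (hev.and self_mem_nhdsWithin).exists
  have hupos' : (0 : ℝ) < u := hupos
  have h3 := hphi u hupos'.le
  have h4 : Z₀ * Real.exp (κ * u) - Z₀ < JE ^ 2 / 2 * S * u := by
    have := (inv_mul_lt_iff₀ hupos').1 hu
    linarith
  linarith

/-- **The fluctuation bound** `⟨X_h²⟩ ≤ (N/J_E) ‖h‖²` for the one-layer model on the even torus
(`L ≥ 4`), `ρ` continuous unitary, `J_E > 0`, `J_M ≥ 0` (Gaussian domination + second order).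
[cite: BorgsSeiler1983, §III.1 (III.13)–(III.15) (p. 346)] -/
theorem expectation_shiftLin_sq_le [NeZero L] (hL : Even L) (hL4 : 4 ≤ L)
    (hρu : ∀ g, ρ g ∈ Matrix.unitaryGroup (Fin N) ℂ) (hρ : Continuous ρ) {JE : ℝ} (hJE : 0 < JE)
    {JM : ℝ} (hJM : 0 ≤ JM) (h : TorusSite d L × Fin d → ℂ) :
    expectation ρ JE JM (fun U : Config d L G => shiftLin ρ h U ^ 2) ≤ N / JE * fieldNormSq h := by
  have hZ := partitionFunction_pos (d := d) (L := L) (G := G) ρ hρ JE JM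
  have hmain := integral_weight_shiftLin_sq_le ρ hρ hJE JM h
    (fun t => gaussZ_le_gaussZ_zero ρ JE JM hL hL4 hρu hρ hJE.le hJM (t • h))
  unfold expectation
  rw [div_le_iff₀ hZ]
  have hcomm : ∫ U, shiftLin ρ h U ^ 2 * weight ρ JE JM U ∂piMeasure (ι := Link d L) (haarProbability G) =
      ∫ U, weight ρ JE JM U * shiftLin ρ h U ^ 2 ∂piMeasure (ι := Link d L) (haarProbability G) :=
    integral_congr_ae (ae_of_all _ fun U => mul_comm _ _)
  rw [hcomm]
  have h1 : JE * (N / JE * fieldNormSq h *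
      ∫ U, weight ρ JE JM U ∂piMeasure (ι := Link d L) (haarProbability G)) =
      N * fieldNormSq h * ∫ U, weight ρ JE JM U ∂piMeasure (ι := Link d L) (haarProbability G) := by
    field_simp
  have h2 : JE * ∫ U, weight ρ JE JM U * shiftLin ρ h U ^ 2 ∂piMeasure (ι := Link d L) (haarProbability G) ≤
      JE * (N / JE * fieldNormSq h * ∫ U, weight ρ JE JM U ∂piMeasure (ι := Link d L) (haarProbability G)) := by
    rw [h1]; exact hmain
  exact le_of_mul_le_mul_left h2 hJE

end SecondOrder

/-! ### Plane waves -/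

section PlaneWaves

variable {d L : ℕ} [NeZero L] {G : Type*} [Group G] {N : ℕ} (ρ : G →* Matrix (Fin N) (Fin N) ℂ)

/-- The character-weighted gradient `D_c(U) = Σ_x c̄(x) (χ(u_x) - χ(u_{x+e_{i₀}}))`. [cite: BorgsSeiler1983, §III.1 proof of Thm III.4 (p. 347: "setting `Δh = g`")] -/
def charGrad (i₀ : Fin d) (c : TorusSite d L → ℂ) (U : Config d L G) : ℂ :=
  ∑ x : TorusSite d L, conj (c x) * (polyakov ρ U x - polyakov ρ U (x + Pi.single i₀ 1))

/-- The plane-wave bond field in direction `i₀` with coefficient `γ`: `h_{x,i} = δ_{i,i₀} γ c(x)`. [cite: FriedliVelenik2017, §10.5.3, proof of Thm. 10.24] -/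
def planeField (i₀ : Fin d) (γ : ℂ) (c : TorusSite d L → ℂ) : TorusSite d L × Fin d → ℂ :=
  fun b => if b.2 = i₀ then γ * c b.1 else 0

/-- `X_{planeField} = Re(γ̄ D_c)`. [folklore] -/
theorem shiftLin_planeField (i₀ : Fin d) (γ : ℂ) (c : TorusSite d L → ℂ) (U : Config d L G) :
    shiftLin ρ (planeField i₀ γ c) U = (conj γ * charGrad ρ i₀ c U).re := by
  unfold shiftLin charGrad planeField
  rw [Finset.mul_sum, Complex.re_sum, Fintype.sum_prod_type]
  refine Finset.sum_congr rfl fun x _ => ?_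
  rw [Finset.sum_eq_single i₀ (fun i _ hi => by simp [hi]) (fun h => absurd (Finset.mem_univ _) h)]
  simp only [if_true, map_mul]
  congr 1
  ring

/-- `‖planeField‖² = |γ|² L^d` for `|c| ≡ 1`. [folklore] -/
theorem fieldNormSq_planeField (i₀ : Fin d) (γ : ℂ) {c : TorusSite d L → ℂ} (hc : ∀ x, ‖c x‖ = 1) :
    fieldNormSq (planeField i₀ γ c) = ‖γ‖ ^ 2 * (L : ℝ) ^ d := by
  unfold fieldNormSq planeField
  rw [Fintype.sum_prod_type]
  have h : ∀ x : TorusSite d L, ∑ i : Fin d, ‖(if i = i₀ then γ * c x else 0 : ℂ)‖ ^ 2 = ‖γ‖ ^ 2 := by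
    intro x
    rw [Finset.sum_eq_single i₀ (fun i _ hi => by simp [hi]) (fun h => absurd (Finset.mem_univ _) h)]
    simp [hc x]
  simp_rw [h]
  rw [Finset.sum_const, Finset.card_univ, nsmul_eq_mul, Fintype.card_fun, ZMod.card, Fintype.card_fin]
  push_cast
  ring

variable [TopologicalSpace G] [IsTopologicalGroup G] [CompactSpace G] [MeasurableSpace G]
  [BorelSpace G] [SecondCountableTopology G]

/-- Linearity of the one-layer expectation. [folklore] -/
theorem expectation_add (hρ : Continuous ρ) (JE JM : ℝ) {F₁ F₂ : Config d L G → ℝ}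
    (h₁ : Continuous F₁) (h₂ : Continuous F₂) :
    expectation ρ JE JM (fun U => F₁ U + F₂ U) = expectation ρ JE JM F₁ + expectation ρ JE JM F₂ := by
  have i1 : Integrable (fun U => F₁ U * weight ρ JE JM U) (piMeasure (ι := Link d L) (haarProbability G)) :=
    integrable_of_continuous (h₁.mul (continuous_weight ρ hρ JE JM))
  have i2 : Integrable (fun U => F₂ U * weight ρ JE JM U) (piMeasure (ι := Link d L) (haarProbability G)) :=
    integrable_of_continuous (h₂.mul (continuous_weight ρ hρ JE JM))
  unfold expectation
  rw [← add_div, ← integral_add i1 i2]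
  congr 1
  exact integral_congr_ae (ae_of_all _ fun U => by simp only; ring)

omit [IsTopologicalGroup G] [CompactSpace G] [MeasurableSpace G] [BorelSpace G] [SecondCountableTopology G] in
/-- `D_c` is continuous. [folklore] -/
theorem continuous_charGrad (hρ : Continuous ρ) (i₀ : Fin d) (c : TorusSite d L → ℂ) :
    Continuous (charGrad (G := G) ρ i₀ c) := by
  unfold charGrad
  exact continuous_finsetSum _ fun x _ => continuous_const.mul
    ((continuous_polyakov ρ hρ _).sub (continuous_polyakov ρ hρ _))

/-- **The plane-wave fluctuation bound**: for `|c| ≡ 1`,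
`⟨|Σ_x c̄(x)(χ(u_x) - χ(u_{x+e_{i₀}}))|²⟩ ≤ 2 N L^d / J_E` (apply the fluctuation bound to
`h = δ_{i,i₀} γ c` with `γ = 1` and `γ = i` and add). [cite: BorgsSeiler1983, §III.1 Thm III.4 and its proof (pp. 346–347)] -/
theorem expectation_normSq_charGrad_le (hL : Even L) (hL4 : 4 ≤ L)
    (hρu : ∀ g, ρ g ∈ Matrix.unitaryGroup (Fin N) ℂ) (hρ : Continuous ρ) {JE : ℝ} (hJE : 0 < JE)
    {JM : ℝ} (hJM : 0 ≤ JM) (i₀ : Fin d) {c : TorusSite d L → ℂ} (hc : ∀ x, ‖c x‖ = 1) :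
    expectation ρ JE JM (fun U : Config d L G => ‖charGrad ρ i₀ c U‖ ^ 2) ≤ 2 * N * (L : ℝ) ^ d / JE := by
  have h1 := expectation_shiftLin_sq_le ρ hL hL4 hρu hρ hJE hJM (planeField i₀ 1 c)
  have hI := expectation_shiftLin_sq_le ρ hL hL4 hρu hρ hJE hJM (planeField i₀ Complex.I c)
  rw [fieldNormSq_planeField i₀ _ hc] at h1 hI
  simp only [shiftLin_planeField, map_one, one_mul, norm_one, one_pow, Complex.conj_I,
    Complex.norm_I] at h1 hI
  have hre : ∀ z : ℂ, (-Complex.I * z).re = z.im := fun z => by simp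
  simp only [hre] at hI
  have hsum : expectation ρ JE JM (fun U : Config d L G => ‖charGrad ρ i₀ c U‖ ^ 2) =
      expectation ρ JE JM (fun U : Config d L G => (charGrad ρ i₀ c U).re ^ 2) +
        expectation ρ JE JM (fun U : Config d L G => (charGrad ρ i₀ c U).im ^ 2) := by
    rw [← expectation_add ρ hρ JE JM]
    · congr 1
      funext U
      rw [Complex.sq_norm, Complex.normSq_apply]; ring
    · exact (Complex.continuous_re.comp (continuous_charGrad ρ hρ i₀ c)).pow 2
    · exact (Complex.continuous_im.comp (continuous_charGrad ρ hρ i₀ c)).pow 2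
  rw [hsum]
  have : (N : ℝ) / JE * (1 * (L : ℝ) ^ d) + N / JE * (1 * (L : ℝ) ^ d) = 2 * N * (L : ℝ) ^ d / JE := by ring
  linarith

/-- **Shifting a character sum**: `Σ_x χ̄_k(x) χ(u_{x+e}) = χ_k(e) Σ_x χ̄_k(x) χ(u_x)`. [folklore] -/
theorem sum_conj_torusChar_mul_shift (k : TorusSite d L) (e : TorusSite d L) (f : TorusSite d L → ℂ) :
    ∑ x, conj (torusChar k x) * f (x + e) = torusChar k e * ∑ x, conj (torusChar k x) * f x := by
  rw [Finset.mul_sum]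
  rw [← Equiv.sum_comp (Equiv.subRight e) (fun x => conj (torusChar k x) * f (x + e))]
  refine Finset.sum_congr rfl fun x _ => ?_
  simp only [Equiv.subRight_apply, sub_add_cancel]
  rw [torusChar_sub_right, map_mul, Complex.conj_conj]
  ring

/-- `Σ_x χ_k(x) f(x + e) = χ̄_k(e) Σ_x χ_k(x) f(x)`. [folklore] -/
theorem sum_torusChar_mul_shift (k : TorusSite d L) (e : TorusSite d L) (f : TorusSite d L → ℂ) :
    ∑ x, torusChar k x * f (x + e) = conj (torusChar k e) * ∑ x, torusChar k x * f x := by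
  rw [Finset.mul_sum]
  rw [← Equiv.sum_comp (Equiv.subRight e) (fun x => torusChar k x * f (x + e))]
  refine Finset.sum_congr rfl fun x _ => ?_
  simp only [Equiv.subRight_apply, sub_add_cancel]
  rw [torusChar_sub_right]
  ring

/-- `|1 - χ_k(e_{i})|² = 2 (1 - cos pᵢ)`. [folklore] -/
theorem normSq_one_sub_torusChar_single (hL2 : 2 ≤ L) (k : TorusSite d L) (i : Fin d) :
    ‖1 - torusChar k (Pi.single i 1)‖ ^ 2 = 2 * (1 - Real.cos (latticeMomentum L k i)) := by
  rw [torusChar_single hL2, ← Complex.normSq_eq_norm_sq, normSq_one_sub_exp_mul_I]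

/-- `|1 - χ̄_k(e_{i})|² = 2 (1 - cos pᵢ)`. [folklore] -/
theorem normSq_one_sub_conj_torusChar_single (hL2 : 2 ≤ L) (k : TorusSite d L) (i : Fin d) :
    ‖1 - conj (torusChar k (Pi.single i 1))‖ ^ 2 = 2 * (1 - Real.cos (latticeMomentum L k i)) := by
  rw [← normSq_one_sub_torusChar_single hL2 k i, ← Complex.norm_conj (1 - torusChar k _), map_sub, map_one]

/-- The Fourier modes of the Polyakov loop, `F_k(U) = Σ_x χ̄_k(x) χ(u_x)` and `F̄'_k(U) = Σ_x χ_k(x) χ(u_x)`. [cite: BorgsSeiler1983, §III.1 Thm III.4 (p. 346)] -/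
def polyakovMode (k : TorusSite d L) (U : Config d L G) : ℂ := ∑ x, conj (torusChar k x) * polyakov ρ U x

/-- The conjugate-character mode `Σ_x χ_k(x) χ(u_x)`. [folklore] -/
def polyakovMode' (k : TorusSite d L) (U : Config d L G) : ℂ := ∑ x, torusChar k x * polyakov ρ U x

omit [TopologicalSpace G] [IsTopologicalGroup G] [CompactSpace G] [MeasurableSpace G] [BorelSpace G]
  [SecondCountableTopology G] in
/-- `D_{χ_k} = (1 - χ_k(e_{i₀})) F_k`. [folklore] -/
theorem charGrad_torusChar (k : TorusSite d L) (i₀ : Fin d) (U : Config d L G) :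
    charGrad ρ i₀ (torusChar k) U = (1 - torusChar k (Pi.single i₀ 1)) * polyakovMode ρ k U := by
  unfold charGrad polyakovMode
  simp only [mul_sub, Finset.sum_sub_distrib]
  rw [sum_conj_torusChar_mul_shift k (Pi.single i₀ 1) (fun x => polyakov ρ U x)]
  ring

omit [TopologicalSpace G] [IsTopologicalGroup G] [CompactSpace G] [MeasurableSpace G] [BorelSpace G]
  [SecondCountableTopology G] in
/-- `D_{χ̄_k} = (1 - χ̄_k(e_{i₀})) F'_k`. [folklore] -/
theorem charGrad_conj_torusChar (k : TorusSite d L) (i₀ : Fin d) (U : Config d L G) :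
    charGrad ρ i₀ (fun x => conj (torusChar k x)) U =
      (1 - conj (torusChar k (Pi.single i₀ 1))) * polyakovMode' ρ k U := by
  unfold charGrad polyakovMode'
  simp only [Complex.conj_conj, mul_sub, Finset.sum_sub_distrib]
  rw [sum_torusChar_mul_shift k (Pi.single i₀ 1) (fun x => polyakov ρ U x)]
  ring

omit [SecondCountableTopology G] in
/-- Homogeneity of the one-layer expectation: `⟨a · F⟩ = a ⟨F⟩`. [folklore] -/
theorem expectation_const_mul (JE JM a : ℝ) (F : Config d L G → ℝ) :
    expectation ρ JE JM (fun U => a * F U) = a * expectation ρ JE JM F := by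
  unfold expectation
  rw [mul_div_assoc']
  congr 1
  rw [← integral_const_mul]
  exact integral_congr_ae (ae_of_all _ fun U => by dsimp only; ring)

/-- **The infrared bound for the Polyakov modes**: `(1 - cos p_{i₀}) ⟨|F_k|²⟩ ≤ N L^d / J_E` and the
same for `F'_k`. [cite: BorgsSeiler1983, §III.1 Thm III.4 (III.16) (p. 346)] -/
theorem one_sub_cos_mul_expectation_polyakovMode_le (hL : Even L) (hL4 : 4 ≤ L)
    (hρu : ∀ g, ρ g ∈ Matrix.unitaryGroup (Fin N) ℂ) (hρ : Continuous ρ) {JE : ℝ} (hJE : 0 < JE)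
    {JM : ℝ} (hJM : 0 ≤ JM) (k : TorusSite d L) (i₀ : Fin d) :
    (1 - Real.cos (latticeMomentum L k i₀)) *
        expectation ρ JE JM (fun U : Config d L G => ‖polyakovMode ρ k U‖ ^ 2) ≤ N * (L : ℝ) ^ d / JE ∧
    (1 - Real.cos (latticeMomentum L k i₀)) *
        expectation ρ JE JM (fun U : Config d L G => ‖polyakovMode' ρ k U‖ ^ 2) ≤ N * (L : ℝ) ^ d / JE := by
  have hL2 : 2 ≤ L := by omega
  constructor
  · have h := expectation_normSq_charGrad_le ρ hL hL4 hρu hρ hJE hJM i₀ (c := torusChar k)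
      (fun x => norm_torusChar k x)
    simp only [charGrad_torusChar, norm_mul, mul_pow, normSq_one_sub_torusChar_single hL2,
      expectation_const_mul] at h
    have e : 2 * (N : ℝ) * (L : ℝ) ^ d / JE = 2 * (N * (L : ℝ) ^ d / JE) := by ring
    rw [e] at h
    linarith
  · have h := expectation_normSq_charGrad_le ρ hL hL4 hρu hρ hJE hJM i₀ (c := fun x => conj (torusChar k x))
      (fun x => by rw [Complex.norm_conj]; exact norm_torusChar k x)
    simp only [charGrad_conj_torusChar, norm_mul, mul_pow, normSq_one_sub_conj_torusChar_single hL2,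
      expectation_const_mul] at h
    have e : 2 * (N : ℝ) * (L : ℝ) ^ d / JE = 2 * (N * (L : ℝ) ^ d / JE) := by ring
    rw [e] at h
    linarith

end PlaneWaves

end OneLayer

/-! ### Theorem III.4 in the tree's predicate form, and Corollary III.5 -/

section InfraredOneLayer

open FiniteTemperature Literature.MathematicalPhysics.QuantumLattice
open Literature.Probability.LatticeModels (TorusSite torusChar torusFourier latticeMomentum
  norm_torusChar torusFourier_eq_sum_torusChar latticeGreen torusChar_add_right torusChar_mul_conj)

variable {d : ℕ} {G : Type*} [Group G] {N : ℕ} (ρ : G →* Matrix (Fin N) (Fin N) ℂ)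
  [TopologicalSpace G] [IsTopologicalGroup G] [CompactSpace G] [MeasurableSpace G] [BorelSpace G]
  [SecondCountableTopology G]

omit [SecondCountableTopology G] in
/-- **The general bridge**: one-layer expectations are finite-temperature expectations at `L₀ = 1`. [folklore] -/
theorem OneLayer.expectation_eq_expectation_one {L : ℕ} [NeZero L] (JE JM : ℝ) (F : OneLayer.Config d L G → ℝ) :
    OneLayer.expectation ρ JE JM F =
      FiniteTemperature.expectation (d := d) (L₀ := 1) (L := L) ρ JE JM
        (fun U => F (OneLayer.toOneLayer d L G U)) := by
  unfold OneLayer.expectation FiniteTemperature.expectation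
  have hmp := OneLayer.measurePreserving_toOneLayer (d := d) (L := L) (G := G)
  rw [← hmp.integral_comp', ← hmp.integral_comp']
  simp only [OneLayer.weight_one_eq]

omit [TopologicalSpace G] [IsTopologicalGroup G] [CompactSpace G] [BorelSpace G] [SecondCountableTopology G] in
/-- The Polyakov mode transported: `F_k ∘ toOneLayer = Σ_x χ̄_k(x) polyakovTrace`. [folklore] -/
theorem OneLayer.polyakovMode_toOneLayer {L : ℕ} [NeZero L] (k : TorusSite d L) (U : FiniteTemperature.Config d 1 L G) :
    OneLayer.polyakovMode ρ k (OneLayer.toOneLayer d L G U) = ∑ x, conj (torusChar k x) * polyakovTrace ρ U x := by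
  unfold OneLayer.polyakovMode
  simp only [OneLayer.polyakovTrace_one_eq]

omit [TopologicalSpace G] [IsTopologicalGroup G] [CompactSpace G] [BorelSpace G] [SecondCountableTopology G] in
/-- The conjugate mode transported. [folklore] -/
theorem OneLayer.polyakovMode'_toOneLayer {L : ℕ} [NeZero L] (k : TorusSite d L) (U : FiniteTemperature.Config d 1 L G) :
    OneLayer.polyakovMode' ρ k (OneLayer.toOneLayer d L G U) = ∑ x, torusChar k x * polyakovTrace ρ U x := by
  unfold OneLayer.polyakovMode'
  simp only [OneLayer.polyakovTrace_one_eq]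

/-- **The expectation of a squared Polyakov sum against the kernel**:
`⟨|Σ_x a_x χ(g_{L_x})|²⟩ = Re Σ_{x,y} a_x ā_y K(x, y)`, `K` the complex Polyakov kernel (II.22). [cite: BorgsSeiler1983, §III.1 proof of Cor. III.5 (p. 347)] -/
theorem FiniteTemperature.expectation_normSq_sum_eq {L₀ L : ℕ} [NeZero L₀] [NeZero L] (hρ : Continuous ρ)
    (JE JM : ℝ) (a : (Fin d → ZMod L) → ℂ) :
    FiniteTemperature.expectation (d := d) (L₀ := L₀) ρ JE JM
        (fun U => ‖∑ x, a x * polyakovTrace ρ U x‖ ^ 2) =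
      (∑ x, ∑ y, a x * conj (a y) * polyakovKernel (L₀ := L₀) ρ JE JM x y).re := by
  set A : FiniteTemperature.Config d L₀ L G → ℂ := fun U => ∑ x, a x * polyakovTrace ρ U x with hA
  have hsum : ∑ x, ∑ y, a x * conj (a y) * polyakovKernel (L₀ := L₀) ρ JE JM x y =
      (∫ U, ((‖A U‖ ^ 2 * weight ρ JE JM U : ℝ) : ℂ) ∂haar d L₀ L G) /
        ((∫ U, weight ρ JE JM U ∂haar d L₀ L G : ℝ) : ℂ) := by
    unfold polyakovKernel
    simp_rw [mul_div_assoc', ← Finset.sum_div]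
    congr 1
    have hint : ∀ x y, Integrable (fun U : FiniteTemperature.Config d L₀ L G => a x * conj (a y) *
        (polyakovTrace ρ U x * conj (polyakovTrace ρ U y) * (weight ρ JE JM U : ℂ)))
        (haar d L₀ L G) :=
      fun x y => (integrable_polyakovKernel_integrand ρ hρ JE JM x y).const_mul _
    simp_rw [← integral_const_mul]
    have hinner : ∀ x, ∑ y, ∫ U, a x * conj (a y) *
        (polyakovTrace ρ U x * conj (polyakovTrace ρ U y) * (weight ρ JE JM U : ℂ))
          ∂haar d L₀ L G =
        ∫ U, ∑ y, a x * conj (a y) *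
          (polyakovTrace ρ U x * conj (polyakovTrace ρ U y) * (weight ρ JE JM U : ℂ))
          ∂haar d L₀ L G :=
      fun x => (integral_finsetSum _ fun y _ => hint x y).symm
    simp_rw [hinner]
    rw [← integral_finsetSum _ fun x _ => integrable_finsetSum _ fun y _ => hint x y]
    refine integral_congr_ae (Eventually.of_forall fun U => ?_)
    have hnorm : ((‖A U‖ ^ 2 : ℝ) : ℂ) = A U * conj (A U) := by
      rw [Complex.mul_conj, Complex.normSq_eq_norm_sq, Complex.ofReal_pow]
    dsimp only
    rw [Complex.ofReal_mul, hnorm, hA]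
    simp only [map_sum, map_mul, Finset.sum_mul, Finset.mul_sum]
    conv_rhs => rw [Finset.sum_comm]
    refine Finset.sum_congr rfl fun x _ => Finset.sum_congr rfl fun y _ => ?_
    ring
  rw [hsum, integral_complex_ofReal, ← Complex.ofReal_div, Complex.ofReal_re]
  unfold FiniteTemperature.expectation
  rfl

omit [SecondCountableTopology G] in
/-- **Translation invariance in Fourier variables**:
`Σ_{x,y} χ̄_k(x) χ_k(y) K(x,y) = L^d Σ_z χ_k(z) K(0,z)` and `Σ_{x,y} χ_k(x) χ̄_k(y) K(x,y) = L^d Σ_z χ̄_k(z) K(0,z)`. [cite: BorgsSeiler1983, §II.3 (II.22) (p. 337, translation invariance)] -/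
theorem FiniteTemperature.sum_sum_torusChar_polyakovKernel {L₀ L : ℕ} [NeZero L₀] [NeZero L]
    (JE JM : ℝ) (k : TorusSite d L) :
    (∑ x, ∑ y, conj (torusChar k x) * conj (conj (torusChar k y)) *
        polyakovKernel (L₀ := L₀) ρ JE JM x y =
      (L : ℂ) ^ d * ∑ z, torusChar k z * polyakovKernel (L₀ := L₀) ρ JE JM 0 z) ∧
    (∑ x, ∑ y, torusChar k x * conj (torusChar k y) * polyakovKernel (L₀ := L₀) ρ JE JM x y =
      (L : ℂ) ^ d * ∑ z, conj (torusChar k z) * polyakovKernel (L₀ := L₀) ρ JE JM 0 z) := by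
  have hK : ∀ x y : TorusSite d L, polyakovKernel (L₀ := L₀) ρ JE JM x y =
      polyakovKernel (L₀ := L₀) ρ JE JM 0 (y - x) := fun x y => by
    rw [← polyakovKernel_add ρ JE JM 0 (y - x) x, zero_add, sub_add_cancel]
  have hcard : (Finset.univ : Finset (TorusSite d L)).card = L ^ d := by
    rw [Finset.card_univ, Fintype.card_fun, ZMod.card, Fintype.card_fin]
  constructor
  · have hinner : ∀ x : TorusSite d L, ∑ y, conj (torusChar k x) * conj (conj (torusChar k y)) *
        polyakovKernel (L₀ := L₀) ρ JE JM x y = ∑ z, torusChar k z * polyakovKernel (L₀ := L₀) ρ JE JM 0 z := by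
      intro x
      rw [← Equiv.sum_comp (Equiv.addRight x)]
      refine Finset.sum_congr rfl fun z _ => ?_
      simp only [Equiv.coe_addRight, Complex.conj_conj, hK x (z + x), add_sub_cancel_right,
        torusChar_add_right]
      have h1 := torusChar_mul_conj k x
      linear_combination (torusChar k z * polyakovKernel (L₀ := L₀) ρ JE JM 0 z) * h1
    simp_rw [hinner]
    rw [Finset.sum_const, hcard, nsmul_eq_mul]
    push_cast
    ring
  · have hinner : ∀ x : TorusSite d L, ∑ y, torusChar k x * conj (torusChar k y) *
        polyakovKernel (L₀ := L₀) ρ JE JM x y = ∑ z, conj (torusChar k z) * polyakovKernel (L₀ := L₀) ρ JE JM 0 z := by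
      intro x
      rw [← Equiv.sum_comp (Equiv.addRight x)]
      refine Finset.sum_congr rfl fun z _ => ?_
      simp only [Equiv.coe_addRight, hK x (z + x), add_sub_cancel_right, torusChar_add_right, map_mul]
      have h1 := torusChar_mul_conj k x
      linear_combination (conj (torusChar k z) * polyakovKernel (L₀ := L₀) ρ JE JM 0 z) * h1
    simp_rw [hinner]
    rw [Finset.sum_const, hcard, nsmul_eq_mul]
    push_cast
    ring

/-- **`Re Ĝ_L(k)` through the two Polyakov modes**:
`2 L^d Re Ĝ_L(k) = ⟨|Σ χ̄_k P|²⟩ + ⟨|Σ χ_k P|²⟩`. [cite: BorgsSeiler1983, §III.1 proof of Cor. III.5 (p. 347)] -/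
theorem FiniteTemperature.two_mul_card_mul_torusFourier_re_eq {L₀ L : ℕ} [NeZero L₀] [NeZero L]
    (hρ : Continuous ρ) (JE JM : ℝ) (k : TorusSite d L) :
    2 * (L : ℝ) ^ d *
        (torusFourier (fun x => (polyakovCorrelation (L₀ := L₀) ρ JE JM x : ℂ)) k).re =
      FiniteTemperature.expectation (d := d) (L₀ := L₀) ρ JE JM
          (fun U => ‖∑ x, conj (torusChar k x) * polyakovTrace ρ U x‖ ^ 2) +
        FiniteTemperature.expectation (d := d) (L₀ := L₀) ρ JE JM
          (fun U => ‖∑ x, torusChar k x * polyakovTrace ρ U x‖ ^ 2) := by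
  have hA := FiniteTemperature.expectation_normSq_sum_eq (L₀ := L₀) ρ hρ JE JM (fun x => conj (torusChar k x))
  have hB := FiniteTemperature.expectation_normSq_sum_eq (L₀ := L₀) ρ hρ JE JM (torusChar k)
  rw [hA, hB, (FiniteTemperature.sum_sum_torusChar_polyakovKernel ρ JE JM k).1,
    (FiniteTemperature.sum_sum_torusChar_polyakovKernel ρ JE JM k).2, ← Complex.add_re, ← mul_add,
    ← Finset.sum_add_distrib, torusFourier_eq_sum_torusChar]
  simp_rw [← add_mul, polyakovCorrelation_eq_re_polyakovKernel ρ hρ JE JM]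
  have hLd : ((L : ℂ) ^ d) = (((L : ℝ) ^ d : ℝ) : ℂ) := by norm_cast
  rw [hLd, Complex.re_ofReal_mul, Complex.re_sum, Complex.re_sum, Finset.mul_sum, Finset.mul_sum]
  refine Finset.sum_congr rfl fun z _ => ?_
  have h2 : torusChar k z + conj (torusChar k z) = ((2 * (torusChar k z).re : ℝ) : ℂ) :=
    Complex.add_conj _
  rw [h2, Complex.re_ofReal_mul, Complex.mul_re, Complex.ofReal_re, Complex.ofReal_im, zero_mul,
    sub_zero, Complex.conj_re]
  ring

/-- **Borgs–Seiler's one-layer infrared bound (Theorem III.4), proved**: for every compact group `G`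
with a continuous unitary `N × N` matrix representation `ρ` and every space dimension `d`, the
finite-temperature theory at maximal lattice temperature (`L₀ = 1`) satisfies the infrared bound
`(1 - cos pᵢ) Re Ĝ_L(p) ≤ N / J_E` for every even periodic box of side `L ≥ 4`, all `J_E, J_M > 0`,
every lattice momentum `p = 2πk/L` (`k ≠ 0` not even needed) and every direction `i` — the tree's
predicate `FiniteTemperature.HasPolyakovInfraredBound d 1 ρ (fun J => N / J)`. Printed:
"Theorem III.4 … Then for any compact Lie group `Σᵢ (1 - cos pᵢ) Ĝ(p) ≤ …/J_E` (III.16)", proved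
there from Lemma III.1 (`|Z({h})| ≤ Z({0})`) "by setting `Δh = g`"; here from Gaussian domination
by reflection positivity (`OneLayer.gaussZ_le_gaussZ_zero`) and the plane waves of
Friedli–Velenik's proof of Thm. 10.24. [cite: BorgsSeiler1983, §III.1 Thm III.4 (III.16) (p. 346)] -/
theorem hasPolyakovInfraredBound_one (hρu : ∀ g, ρ g ∈ Matrix.unitaryGroup (Fin N) ℂ) (hρ : Continuous ρ) :
    HasPolyakovInfraredBound d 1 ρ (fun J => N / J) := by
  intro L _ hL hL4 JE JM hJE hJM k i _
  have hL0 : (0 : ℝ) < (L : ℝ) ^ d := by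
    have : (0 : ℝ) < L := by exact_mod_cast (show 0 < L by omega)
    positivity
  obtain ⟨hA, hB⟩ := OneLayer.one_sub_cos_mul_expectation_polyakovMode_le ρ hL hL4 hρu hρ hJE hJM.le k i
  rw [OneLayer.expectation_eq_expectation_one] at hA hB
  simp only [OneLayer.polyakovMode_toOneLayer, OneLayer.polyakovMode'_toOneLayer] at hA hB
  have hsum := FiniteTemperature.two_mul_card_mul_torusFourier_re_eq (L₀ := 1) ρ hρ JE JM k
  -- `(1 - cos) · 2 L^d Re Ĝ ≤ 2 N L^d / J_E`
  have hcos : 0 ≤ 1 - Real.cos (latticeMomentum L k i) := sub_nonneg.2 (Real.cos_le_one _)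
  have h3 : (1 - Real.cos (latticeMomentum L k i)) * (2 * (L : ℝ) ^ d *
      (torusFourier (fun x => (polyakovCorrelation (L₀ := 1) ρ JE JM x : ℂ)) k).re) ≤
      2 * (N * (L : ℝ) ^ d / JE) := by
    rw [hsum, mul_add]; linarith
  have h4 : (1 - Real.cos (latticeMomentum L k i)) *
      (torusFourier (fun x => (polyakovCorrelation (L₀ := 1) ρ JE JM x : ℂ)) k).re * (2 * (L : ℝ) ^ d) ≤
      N / JE * (2 * (L : ℝ) ^ d) := by
    calc _ = (1 - Real.cos (latticeMomentum L k i)) * (2 * (L : ℝ) ^ d *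
          (torusFourier (fun x => (polyakovCorrelation (L₀ := 1) ρ JE JM x : ℂ)) k).re) := by ring
      _ ≤ 2 * (N * (L : ℝ) ^ d / JE) := h3
      _ = N / JE * (2 * (L : ℝ) ^ d) := by ring
  exact le_of_mul_le_mul_right h4 (by positivity)

/-- The rate `N / J → 0`. [folklore] -/
theorem tendsto_const_div_atTop_zero (N : ℕ) : Tendsto (fun J : ℝ => (N : ℝ) / J) atTop (𝓝 0) :=
  tendsto_const_nhds.div_atTop tendsto_id

/-- **Corollary III.5 (deconfinement at maximal lattice temperature), proved**: for a compact group
with a continuous unitary `N × N` representation (`N ≥ 1`), in `d ≥ 3` space dimensions, there is a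
threshold `J₀` such that for all `J_E ≥ J₀` and all `J_M > 0` the Polyakov loops of the `L₀ = 1`
theory have long-range order (`HasPolyakovLongRangeOrder d 1 ρ J_E J_M`): the infrared bound
(`hasPolyakovInfraredBound_one`), the diagonal bound `G_L(0) ≥ 1`
(`one_le_polyakovCorrelation_zero`) and the tree's mechanism
`hasPolyakovLongRangeOrder_of_infraredBound`. Printed: "In the `U(N)` or `SU(N)` lattice Yang-Mills
model with Wilson's action and maximal lattice temperature external "quarks" are liberated for
`J_E ≥ N I(d)`". [cite: BorgsSeiler1983, §III.1 Cor. III.5 and proof (pp. 347–348)] -/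
theorem hasPolyakovLongRangeOrder_one (hρu : ∀ g, ρ g ∈ Matrix.unitaryGroup (Fin N) ℂ) (hρ : Continuous ρ)
    (hN : N ≠ 0) (hd : 3 ≤ d) :
    ∃ J₀ : ℝ, ∀ JE JM : ℝ, J₀ ≤ JE → 0 < JM → HasPolyakovLongRangeOrder d 1 ρ JE JM := by
  obtain ⟨J₁, hJ₁⟩ := exists_threshold_of_tendsto (d := d) (tendsto_const_div_atTop_zero N)
  refine ⟨max J₁ 1, fun JE JM hJE hJM => ?_⟩
  have hJE0 : 0 < JE := lt_of_lt_of_le one_pos ((le_max_right _ _).trans hJE)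
  have hdiag : HasPolyakovDiagonalBound d 1 ρ := fun L _ _ _ JE' JM' hJE' _ =>
    one_le_polyakovCorrelation_zero ρ hρu hρ hN hJE'.le JM'
  exact hasPolyakovLongRangeOrder_of_infraredBound ρ hρ hd (hasPolyakovInfraredBound_one ρ hρu hρ) hdiag
    hJE0 hJM (hJ₁ JE ((le_max_left _ _).trans hJE))

/-- **Corollary III.5 for `U(N)`**, `N ≥ 1`, `d ≥ 3`: the `L₀ = 1` clause of the catalogued fact
`FiniteTemperatureDeconfinement`, proved. [cite: BorgsSeiler1983, §III.1 Cor. III.5 (p. 347)] -/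
theorem hasPolyakovLongRangeOrder_one_unitary {N d : ℕ} (hN : 1 ≤ N) (hd : 3 ≤ d) :
    ∃ J₀ : ℝ, ∀ JE JM : ℝ, J₀ ≤ JE → 0 < JM →
      HasPolyakovLongRangeOrder d 1 (unitaryFundamentalRep (Fin N) ℂ) JE JM :=
  hasPolyakovLongRangeOrder_one (unitaryFundamentalRep (Fin N) ℂ) (fun g => g.2)
    (continuous_unitaryFundamentalRep (Fin N) ℂ) (by omega) hd

/-- **Corollary III.5 for `SU(N)`**, `N ≥ 1`, `d ≥ 3`. [cite: BorgsSeiler1983, §III.1 Cor. III.5 (p. 347)] -/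
theorem hasPolyakovLongRangeOrder_one_specialUnitary {N d : ℕ} (hN : 1 ≤ N) (hd : 3 ≤ d) :
    ∃ J₀ : ℝ, ∀ JE JM : ℝ, J₀ ≤ JE → 0 < JM →
      HasPolyakovLongRangeOrder d 1 (fundamentalRep (Fin N)) JE JM :=
  hasPolyakovLongRangeOrder_one (fundamentalRep (Fin N)) fundamentalRep_mem_unitaryGroup
    (continuous_fundamentalRep (Fin N)) (by omega) hd

/-- **The `L₀ = 1` slice of the named fact `BorgsSeilerInfraredBound`, proved** (both clauses, with the
rate `f(J) = N/J`; the fact itself asks this for every temporal extent `L₀`). [cite: BorgsSeiler1983, §III.1 Thm III.4 (III.16) (p. 346)] -/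
theorem borgsSeilerInfraredBound_one :
    (∀ (N d : ℕ), 1 ≤ N → ∃ f : ℝ → ℝ, Tendsto f atTop (𝓝 0) ∧
      HasPolyakovInfraredBound d 1 (unitaryFundamentalRep (Fin N) ℂ) f) ∧
    (∀ (N d : ℕ), 2 ≤ N → ∃ f : ℝ → ℝ, Tendsto f atTop (𝓝 0) ∧
      HasPolyakovInfraredBound d 1 (fundamentalRep (Fin N)) f) :=
  ⟨fun N _ _ => ⟨fun J => N / J, tendsto_const_div_atTop_zero N,
      hasPolyakovInfraredBound_one (unitaryFundamentalRep (Fin N) ℂ) (fun g => g.2)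
        (continuous_unitaryFundamentalRep (Fin N) ℂ)⟩,
    fun N _ _ => ⟨fun J => N / J, tendsto_const_div_atTop_zero N,
      hasPolyakovInfraredBound_one (fundamentalRep (Fin N)) fundamentalRep_mem_unitaryGroup
        (continuous_fundamentalRep (Fin N))⟩⟩

/-- **The `L₀ = 1` slice of the catalogued fact `FiniteTemperatureDeconfinement`, proved** (both
clauses: `U(N)`, `N ≥ 1`, and `SU(N)`, `N ≥ 2`, `d ≥ 3` — Borgs–Seiler's Corollary III.5, "maximal
lattice temperature"). [cite: BorgsSeiler1983, §III.1 Cor. III.5 (p. 347)] -/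
theorem finiteTemperatureDeconfinement_one :
    (∀ (N d : ℕ), 1 ≤ N → 3 ≤ d → ∃ J₀ : ℝ, ∀ JE JM : ℝ, J₀ ≤ JE → 0 < JM →
      HasPolyakovLongRangeOrder d 1 (unitaryFundamentalRep (Fin N) ℂ) JE JM) ∧
    (∀ (N d : ℕ), 2 ≤ N → 3 ≤ d → ∃ J₀ : ℝ, ∀ JE JM : ℝ, J₀ ≤ JE → 0 < JM →
      HasPolyakovLongRangeOrder d 1 (fundamentalRep (Fin N)) JE JM) :=
  ⟨fun _ _ hN hd => hasPolyakovLongRangeOrder_one_unitary hN hd,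
    fun _ _ hN hd => hasPolyakovLongRangeOrder_one_specialUnitary (by omega) hd⟩

/-! ### The temperature-blind barrier theorems, unconditionally -/

/-- Polyakov confinement at all couplings fails at `L₀ = 1` for `U(N)`, `N ≥ 1`, `d ≥ 3`
(unconditionally). [cite: BorgsSeiler1983, §III.1 Cor. III.5 (p. 347)] -/
theorem not_polyakovConfinementAtAllCouplings_one_unitary {N d : ℕ} (hN : 1 ≤ N) (hd : 3 ≤ d) :
    ¬ PolyakovConfinementAtAllCouplings d 1 (unitaryFundamentalRep (Fin N) ℂ) := by
  intro hT
  obtain ⟨J₀, hJ⟩ := hasPolyakovLongRangeOrder_one_unitary hN hd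
  set JE : ℝ := max J₀ 1
  have hJE : 0 < JE := lt_of_lt_of_le one_pos (le_max_right _ _)
  obtain ⟨Ginf, hG⟩ := exists_isThermodynamicLimit (d := d) (L₀ := 1)
    (unitaryFundamentalRep (Fin N) ℂ) (continuous_unitaryFundamentalRep (Fin N) ℂ) (fun g => g.2) JE 1
  exact hJ JE 1 (le_max_left _ _) one_pos Ginf hG (hT JE 1 hJE one_pos Ginf hG)

/-- Polyakov confinement at all couplings fails at `L₀ = 1` for `SU(N)`, `N ≥ 1`, `d ≥ 3`
(unconditionally). [cite: BorgsSeiler1983, §III.1 Cor. III.5 (p. 347)] -/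
theorem not_polyakovConfinementAtAllCouplings_one_specialUnitary {N d : ℕ} (hN : 1 ≤ N) (hd : 3 ≤ d) :
    ¬ PolyakovConfinementAtAllCouplings d 1 (fundamentalRep (Fin N)) := by
  intro hT
  obtain ⟨J₀, hJ⟩ := hasPolyakovLongRangeOrder_one_specialUnitary hN hd
  set JE : ℝ := max J₀ 1
  have hJE : 0 < JE := lt_of_lt_of_le one_pos (le_max_right _ _)
  obtain ⟨Ginf, hG⟩ := exists_isThermodynamicLimit (d := d) (L₀ := 1)
    (fundamentalRep (Fin N)) (continuous_fundamentalRep (Fin N)) fundamentalRep_mem_unitaryGroup JE 1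
  exact hJ JE 1 (le_max_left _ _) one_pos Ginf hG (hT JE 1 hJE one_pos Ginf hG)

/-- **Barrier theorem (i), `U(N)`, unconditionally**: temperature-blind Polyakov confinement is refuted
for the fundamental representation of `U(N)`, `N ≥ 1`, `d ≥ 3` (at the single temporal extent
`L₀ = 1`, Borgs–Seiler Cor. III.5, now a theorem). [cite: BorgsSeiler1983, §III.1 Cor. III.5 (p. 347); §IV (p. 357)] -/
theorem not_temperatureBlindPolyakovConfinement_unitary_holds {N d : ℕ} (hN : 1 ≤ N) (hd : 3 ≤ d) :
    ¬ TemperatureBlindPolyakovConfinement d (unitaryFundamentalRep (Fin N) ℂ) := fun hT =>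
  not_polyakovConfinementAtAllCouplings_one_unitary hN hd (hT 1)

/-- **Barrier theorem (i), `SU(N)`, unconditionally** (`N ≥ 1`, `d ≥ 3`). [cite: BorgsSeiler1983, §III.1 Cor. III.5 (p. 347); §IV (p. 357)] -/
theorem not_temperatureBlindPolyakovConfinement_specialUnitary_holds {N d : ℕ} (hN : 1 ≤ N) (hd : 3 ≤ d) :
    ¬ TemperatureBlindPolyakovConfinement d (fundamentalRep (Fin N)) := fun hT =>
  not_polyakovConfinementAtAllCouplings_one_specialUnitary hN hd (hT 1)

/-- **Barrier theorem (ii), `U(N)`, unconditionally**: no volume-uniform exponential clustering of the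
Polyakov correlation valid at every temporal extent and every coupling. [cite: BorgsSeiler1983, §III.1 Cor. III.5 (p. 347); §II.4 (II.55)–(II.56) (p. 343)] -/
theorem not_temperatureBlindUniformClustering_unitary_holds {N d : ℕ} (hN : 1 ≤ N) (hd : 3 ≤ d) :
    ¬ TemperatureBlindUniformClustering d (unitaryFundamentalRep (Fin N) ℂ) := fun hT =>
  not_temperatureBlindPolyakovConfinement_unitary_holds hN hd hT.polyakovConfinement

/-- **Barrier theorem (ii), `SU(N)`, unconditionally.** [cite: BorgsSeiler1983, §III.1 Cor. III.5 (p. 347); §II.4 (II.55)–(II.56) (p. 343)] -/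
theorem not_temperatureBlindUniformClustering_specialUnitary_holds {N d : ℕ} (hN : 1 ≤ N) (hd : 3 ≤ d) :
    ¬ TemperatureBlindUniformClustering d (fundamentalRep (Fin N)) := fun hT =>
  not_temperatureBlindPolyakovConfinement_specialUnitary_holds hN hd hT.polyakovConfinement

/-- **`FiniteTemperatureDeconfinement` modulo the many-layer infrared bound.** With the diagonal bound
discharged (`BorgsSeilerPolyakovDiagonal_holds`) — and the one-layer case now a theorem
(`hasPolyakovInfraredBound_one`) — Borgs–Seiler's deconfinement theorem for all `L₀` (Thm III.7, the
catalogued fact `FiniteTemperatureDeconfinement`) follows from the single remaining named fact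
`BorgsSeilerInfraredBound` (Lemma III.6 / Cor. III.7, the infrared bound for `L₀ ≥ 2` time layers,
printed proof: transfer matrix and double-commutator expansion, §III.2) by the proved assembly
`FiniteTemperatureDeconfinement.of_infraredBound`. [cite: BorgsSeiler1983, §III.2 Lemma III.6, Thm III.7 (pp. 348–354)] -/
theorem FiniteTemperatureDeconfinement.of_borgsSeilerInfraredBound (hIR : BorgsSeilerInfraredBound) :
    FiniteTemperatureDeconfinement :=
  FiniteTemperatureDeconfinement.of_infraredBound hIR BorgsSeilerPolyakovDiagonal_holds

end InfraredOneLayer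

end Literature.Barriers.QuantumFields

end
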